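import Summits.Langlands.Langlands.Theorems.AbelianSurfaceSerreQuadraticImprimitiveSurfacesCliffordIndexTwo
import HarnessLib

/-!
# Clifford's theorem in index two, multiplicity-one half (Frobenius reciprocity + Schur):
# the Clifford component is NOT conjugate-stable

Crux `AbelianSurfaceSerre.QuadraticImprimitiveSurfaces` (stmt-Langlands-17766), `--supports` helpers
(companion of `…CliffordIndexTwo.lean` / `…CliffordInduced.lean`).  Everything here is PROVED.

Setting: `π` an irreducible representation of `G` on a finite-dimensional `V` over an ALGEBRAICALLY
CLOSED field `k` (any characteristic), `φ : H →* G` with image `N` of index `2`, `U` a proper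
`φ(H)`-stable subspace (a Clifford component: `V = U ⊕ π(g)U` for `g ∉ N`, `…CliffordIndexTwo`).

* `exists_eq_smul_subtype_of_index_two` — every `H`-equivariant linear map `U → V` is a scalar
  multiple of the inclusion: `Hom_N(U, Res V) = k · ι` (this is `dim Hom_G(Ind U, V) = 1`, Frobenius
  reciprocity, made explicit: an equivariant `ψ : U → V` extends to the `G`-endomorphism
  `T = ψ ⊕ π(g) ψ π(g)⁻¹` of `V = U ⊕ π(g)U`, which is a scalar by Schur);
* `eq_zero_of_range_le_map_of_index_two` — hence `Hom_N(U, π(g)U) = 0`;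
* `not_exists_equivariant_injective_of_index_two` — in particular `U ≇ π(g)U` as `N`-modules: the
  two Clifford components are NOT isomorphic, i.e. with `U ↔ s`, `π(g)U ↔ s^g`, the inducing
  representation satisfies `s ≇ s^g` (Mackey's irreducibility criterion, necessity half).

For the crux: with `r = (V_p A)^∨ ⊗ ℚ̄_p` irreducible (Faltings, `End_ℚ(A) = ℤ`) and reducible on
`Γ_K`, `[K:ℚ] = 2`, the rank-2 summand `s` of `r|Γ_K` satisfies `s ≇ s^σ` — the Galois-side
cuspidality condition for the automorphic induction `AI_K^ℚ` in every `GL₂/K` approach, and, at a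
wreath residue `ρ̄ = Ind σ̄` (coefficients `𝔽̄_p`), `σ̄ ≇ σ̄^c` as used in BCGP 2025 §10.4 (type B[C₂]).

References: A. H. Clifford, Ann. of Math. 38 (1937), Thm. 1–2 [Clifford1937]; G. W. Mackey, Amer. J.
Math. 73 (1951) (irreducibility criterion); J.-P. Serre, *Linear representations of finite groups*,
§7.3 Prop. 22, §7.4 Prop. 23 [SerreLinearRepresentations1977].
-/

noncomputable section

set_option linter.dupNamespace false

namespace Summit.Langlands.Langlands.Cruxes.QuadraticImprimitiveSurfaces.Clifford

section Abstract

variable {k : Type*} [Field k] {G H : Type*} [Group G] [Group H] {V : Type*} [AddCommGroup V]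
  [Module k V]

/-- **Every proper non-zero Clifford component is a complement of its conjugate.**  With `π`
irreducible, `[G : φ(H)] = 2`, `W` a sub-`H`-representation of `π ∘ φ` with `W ≠ 0, V` and
`g ∉ φ(H)`: `W ∩ π(g)W = 0` and `W + π(g)W = V` (both are `G`-stable,
`stable_sup_inf_of_index_two`). [cite: Clifford1937, Thm. 1] -/
theorem inf_eq_bot_and_sup_eq_top_of_index_two (π : _root_.Representation k G V)
    (hπ : π.IsIrreducible) (φ : H →* G) (hφ : φ.range.index = 2)
    (W : Subrepresentation (π.comp φ)) (hWb : W ≠ ⊥) (hWt : W ≠ ⊤) {g : G} (hg : g ∉ φ.range) :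
    W.toSubmodule ⊓ W.toSubmodule.map (π g) = ⊥ ∧ W.toSubmodule ⊔ W.toSubmodule.map (π g) = ⊤ := by
  classical
  haveI := hπ
  set U : Submodule k V := W.toSubmodule with hUdef
  have hUb : U ≠ ⊥ := fun h => hWb (Subrepresentation.toSubmodule_injective h)
  have hUt : U ≠ ⊤ := fun h => hWt (Subrepresentation.toSubmodule_injective h)
  have hHU : ∀ (h : H), ∀ v ∈ U, π (φ h) v ∈ U := fun h v hv => W.apply_mem_toSubmodule h hv
  have hst := stable_sup_inf_of_index_two π φ hφ hHU hg
  let S₁ : Subrepresentation π := ⟨U ⊔ U.map (π g), fun x v hv => (hst x).1 v hv⟩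
  let S₂ : Subrepresentation π := ⟨U ⊓ U.map (π g), fun x v hv => (hst x).2 v hv⟩
  have hS₁ : S₁ = ⊤ := by
    rcases IsSimpleOrder.eq_bot_or_eq_top S₁ with h | h
    · exfalso
      apply hUb
      have h' : U ⊔ U.map (π g) = ⊥ := congrArg Subrepresentation.toSubmodule h
      exact le_bot_iff.mp (le_sup_left.trans h'.le)
    · exact h
  have hS₂ : S₂ = ⊥ := by
    rcases IsSimpleOrder.eq_bot_or_eq_top S₂ with h | h
    · exact h
    · exfalso
      apply hUt
      have h' : U ⊓ U.map (π g) = ⊤ := congrArg Subrepresentation.toSubmodule h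
      exact top_le_iff.mp (h'.ge.trans inf_le_left)
  exact ⟨congrArg Subrepresentation.toSubmodule hS₂, congrArg Subrepresentation.toSubmodule hS₁⟩

/-- **Frobenius reciprocity + Schur in index two: `Hom_N(U, Res V) = k · ι`.**  Let `π` be an
irreducible representation of `G` on a finite-dimensional space `V` over an algebraically closed
field, `φ : H →* G` with image `N` of index `2`, and `W ≠ V` a sub-`H`-representation of `π ∘ φ`.
Then every `H`-equivariant linear map `ψ : W → V` is a scalar multiple of the inclusion.  Proof: for
`g ∉ N`, `V = W ⊕ π(g)W`; the map `T := ψ` on `W`, `T := π(g) ∘ ψ ∘ π(g)⁻¹` on `π(g)W` commutes with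
`π(N)` (normality of `N`) and with `π(g)` (`g² ∈ N`), hence with `π(G)`, so `T` is a scalar `c` by
Schur's lemma, and `ψ = T|_W = c · ι`. [cite: Clifford1937, Thm. 2]
[cite: SerreLinearRepresentations1977, §7.3 Prop. 22, §7.4 Prop. 23] -/
theorem exists_eq_smul_subtype_of_index_two {k : Type*} [Field k] {G H : Type*} [Group G]
    [Group H] {V : Type*} [AddCommGroup V] [Module k V] [FiniteDimensional k V] [IsAlgClosed k]
    (π : _root_.Representation k G V) (hπ : π.IsIrreducible) (φ : H →* G)
    (hφ : φ.range.index = 2) (W : Subrepresentation (π.comp φ)) (hWt : W ≠ ⊤)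
    (ψ : W.toSubmodule →ₗ[k] V)
    (hψ : ∀ (h : H) (w : W.toSubmodule), ψ (W.toRepresentation h w) = π (φ h) (ψ w)) :
    ∃ c : k, ψ = c • W.toSubmodule.subtype := by
  classical
  haveI := hπ
  -- the degenerate case `W = 0`
  by_cases hWb : W = ⊥
  · refine ⟨0, ?_⟩
    ext w
    have hU0 : W.toSubmodule = ⊥ := congrArg Subrepresentation.toSubmodule hWb
    have hw : (w : V) ∈ (⊥ : Submodule k V) := hU0.le w.2
    rw [Submodule.mem_bot] at hw
    have : w = 0 := Subtype.ext hw
    simp [this]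
  -- an element outside `N = φ(H)`, normality, products of two non-elements
  obtain ⟨g, hg⟩ : ∃ g : G, g ∉ φ.range := by
    by_contra! h
    have htop : φ.range = ⊤ := eq_top_iff.mpr fun x _ => h x
    rw [htop, Subgroup.index_top] at hφ
    exact absurd hφ (by norm_num)
  haveI hN : φ.range.Normal := Subgroup.normal_of_index_eq_two hφ
  have hmul : ∀ {a b : G}, a ∉ φ.range → b ∉ φ.range → a * b ∈ φ.range := fun ha hb =>
    (Subgroup.mul_mem_iff_of_index_two hφ).mpr (iff_of_false ha hb)
  have hcomp : ∀ (a b : G) (v : V), π a (π b v) = π (a * b) v := fun a b v => by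
    rw [map_mul]; rfl
  -- the Clifford decomposition `V = U ⊕ π(g)U`, `U = W.toSubmodule`
  obtain ⟨hinf, hsup⟩ := inf_eq_bot_and_sup_eq_top_of_index_two π hπ φ hφ W hWb hWt hg
  have hc : IsCompl W.toSubmodule (W.toSubmodule.map (π g)) :=
    ⟨disjoint_iff.mpr hinf, codisjoint_iff.mpr hsup⟩
  let e : W.toSubmodule ≃ₗ[k] W.toSubmodule.map (π g) :=
    Submodule.equivMapOfInjective (π g) (representation_apply_injective π g) W.toSubmodule
  have he : ∀ u : W.toSubmodule, ((e u : W.toSubmodule.map (π g)) : V) = π g (u : V) := fun u =>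
    Submodule.coe_equivMapOfInjective_apply _ _ _ u
  -- every vector decomposes as `u + π(g) u₂`
  have hdec : ∀ v : V, ∃ u u₂ : W.toSubmodule, v = (u : V) + π g (u₂ : V) := by
    intro v
    have hv : v ∈ W.toSubmodule ⊔ W.toSubmodule.map (π g) := by rw [hsup]; exact Submodule.mem_top
    obtain ⟨a, ha, b, hb, rfl⟩ := Submodule.mem_sup.mp hv
    obtain ⟨a₂, ha₂, rfl⟩ := Submodule.mem_map.mp hb
    exact ⟨⟨a, ha⟩, ⟨a₂, ha₂⟩, rfl⟩
  -- the extension `T` of `ψ` to `V`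
  let T₂ : W.toSubmodule.map (π g) →ₗ[k] V := (π g) ∘ₗ ψ ∘ₗ e.symm.toLinearMap
  let T : V →ₗ[k] V := LinearMap.ofIsCompl hc ψ T₂
  have hTU : ∀ u : W.toSubmodule, T (u : V) = ψ u := fun u => LinearMap.ofIsCompl_apply_left hc u
  have hTU' : ∀ u : W.toSubmodule, T (π g (u : V)) = π g (ψ u) := by
    intro u
    rw [← he u, LinearMap.ofIsCompl_apply_right hc]
    simp [T₂]
  -- the action of `φ h` on `U` is `W.toRepresentation h`
  have hWrep : ∀ (h : H) (u : W.toSubmodule),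
      π (φ h) (u : V) = ((W.toRepresentation h u : W.toSubmodule) : V) :=
    fun h u => rfl
  -- `T` commutes with `π (φ h)`
  have hTN : ∀ (h : H) (v : V), T (π (φ h) v) = π (φ h) (T v) := by
    intro h v
    obtain ⟨u, u₂, rfl⟩ := hdec v
    -- `g⁻¹ (φ h) g = φ h₁`
    obtain ⟨h₁, hh₁⟩ : g⁻¹ * φ h * g ∈ φ.range := by
      simpa using hN.conj_mem (φ h) ⟨h, rfl⟩ g⁻¹
    have hgh : g * φ h₁ = φ h * g := by rw [hh₁]; group
    have hconj : π (φ h) (π g (u₂ : V)) = π g (π (φ h₁) (u₂ : V)) := by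
      rw [hcomp, hcomp, hgh]
    rw [map_add, map_add, hconj, hWrep h u, hWrep h₁ u₂, hTU, hTU', map_add, hTU, hTU', hψ, hψ,
      hcomp g (φ h₁), hgh, ← hcomp, ← map_add]
  -- `T` commutes with `π g` (`g² ∈ N`)
  have hTg : ∀ v : V, T (π g v) = π g (T v) := by
    intro v
    obtain ⟨u, u₂, rfl⟩ := hdec v
    obtain ⟨h₂, hh₂⟩ : g * g ∈ φ.range := hmul hg hg
    have hsq : π g (π g (u₂ : V)) = ((W.toRepresentation h₂ u₂ : W.toSubmodule) : V) := by
      rw [hcomp, ← hWrep h₂ u₂, hh₂]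
    rw [map_add, map_add, hsq, hTU', hTU, hψ, map_add, hTU, hTU', map_add, hh₂, ← hcomp]
  -- hence with all of `π(G)` (`G = N ∪ gN`)
  have hT : ∀ (x : G) (v : V), T (π x v) = π x (T v) := by
    intro x v
    by_cases hx : x ∈ φ.range
    · obtain ⟨h, rfl⟩ := hx
      exact hTN h v
    · have hginv : g⁻¹ ∉ φ.range := fun h' => hg (by simpa using φ.range.inv_mem h')
      obtain ⟨h, hh⟩ : g⁻¹ * x ∈ φ.range := hmul hginv hx
      have hx' : x = g * φ h := by rw [hh]; group
      rw [hx', ← hcomp, hTg, hTN, hcomp]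
  -- Schur: `T` is a scalar
  let Ti : π.IntertwiningMap π := T.intertwiningMap_of_isIntertwiningMap π π hT
  obtain ⟨c, hcT⟩ :=
    (Representation.IsIrreducible.algebraMap_intertwiningMap_bijective_of_isAlgClosed
      (ρ := π)).2 Ti
  have hTc : ∀ v : V, T v = c • v := by
    intro v
    have h1 : (algebraMap k (π.IntertwiningMap π) c) v = Ti v := by rw [hcT]
    rw [Representation.IntertwiningMap.algebraMap_apply,
      Representation.IntertwiningMap.smul_apply] at h1
    simpa [Ti] using h1.symm
  refine ⟨c, ?_⟩
  ext u
  rw [← hTU, hTc]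
  simp

/-- **`Hom_N(U, π(g)U) = 0`.**  In the situation of `exists_eq_smul_subtype_of_index_two`, with
`g ∉ φ(H)`, an `H`-equivariant linear map `W → V` with values in `π(g)W` vanishes (it is `c · ι`
with values in `W ∩ π(g)W = 0`). [cite: Clifford1937, Thm. 2]
[cite: SerreLinearRepresentations1977, §7.4 Prop. 23] -/
theorem eq_zero_of_range_le_map_of_index_two [FiniteDimensional k V] [IsAlgClosed k]
    (π : _root_.Representation k G V) (hπ : π.IsIrreducible) (φ : H →* G)
    (hφ : φ.range.index = 2) (W : Subrepresentation (π.comp φ)) (hWt : W ≠ ⊤) {g : G}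
    (hg : g ∉ φ.range) (ψ : W.toSubmodule →ₗ[k] V)
    (hψ : ∀ (h : H) (w : W.toSubmodule), ψ (W.toRepresentation h w) = π (φ h) (ψ w))
    (hr : LinearMap.range ψ ≤ W.toSubmodule.map (π g)) : ψ = 0 := by
  classical
  by_cases hWb : W = ⊥
  · ext w
    have hU0 : W.toSubmodule = ⊥ := congrArg Subrepresentation.toSubmodule hWb
    have hw : (w : V) ∈ (⊥ : Submodule k V) := hU0.le w.2
    rw [Submodule.mem_bot] at hw
    have : w = 0 := Subtype.ext hw
    simp [this]
  obtain ⟨c, rfl⟩ := exists_eq_smul_subtype_of_index_two π hπ φ hφ W hWt ψ hψ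
  obtain ⟨hinf, -⟩ := inf_eq_bot_and_sup_eq_top_of_index_two π hπ φ hφ W hWb hWt hg
  by_cases hc : c = 0
  · simp [hc]
  · exfalso
    apply hWb
    apply Subrepresentation.toSubmodule_injective
    change W.toSubmodule = ⊥
    rw [eq_bot_iff]
    intro u hu
    have h1 : c • u ∈ W.toSubmodule ⊓ W.toSubmodule.map (π g) :=
      Submodule.mem_inf.mpr ⟨W.toSubmodule.smul_mem c hu, hr ⟨⟨u, hu⟩, by simp⟩⟩
    rw [hinf, Submodule.mem_bot, smul_eq_zero] at h1
    exact (Submodule.mem_bot k).mpr (h1.resolve_left hc)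

/-- **The Clifford components are not isomorphic (`U ≇ π(g)U`, i.e. `s ≇ s^g`).**  With `π`
irreducible over an algebraically closed field, `[G : φ(H)] = 2`, `W ≠ 0, V` a sub-`H`-representation
and `g ∉ φ(H)`, there is NO injective `H`-equivariant linear map `W → V` with values in `π(g)W`
(Mackey's irreducibility criterion for `Ind_N^G`, necessity half; for the crux: the rank-2 summand
`s` of `r|Γ_K` is not Galois-conjugate-invariant, the cuspidality condition for `AI_K^ℚ`).
[cite: Clifford1937, Thm. 2] [cite: SerreLinearRepresentations1977, §7.4 Prop. 23 and Cor.] -/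
theorem not_exists_equivariant_injective_of_index_two [FiniteDimensional k V] [IsAlgClosed k]
    (π : _root_.Representation k G V) (hπ : π.IsIrreducible) (φ : H →* G)
    (hφ : φ.range.index = 2) (W : Subrepresentation (π.comp φ)) (hWb : W ≠ ⊥) (hWt : W ≠ ⊤)
    {g : G} (hg : g ∉ φ.range) :
    ¬ ∃ ψ : W.toSubmodule →ₗ[k] V, Function.Injective ψ ∧
        LinearMap.range ψ ≤ W.toSubmodule.map (π g) ∧
        ∀ (h : H) (w : W.toSubmodule), ψ (W.toRepresentation h w) = π (φ h) (ψ w) := by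
  rintro ⟨ψ, hinj, hr, hψ⟩
  have h0 := eq_zero_of_range_le_map_of_index_two π hπ φ hφ W hWt hg ψ hψ hr
  apply hWb
  apply Subrepresentation.toSubmodule_injective
  change W.toSubmodule = ⊥
  rw [eq_bot_iff]
  intro u hu
  have : (⟨u, hu⟩ : W.toSubmodule) = 0 := hinj (by simp [h0])
  exact (Submodule.mem_bot k).mpr (congrArg Subtype.val this)

end Abstract

end Summit.Langlands.Langlands.Cruxes.QuadraticImprimitiveSurfaces.Clifford
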